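import Summits.Parity.GeneralizedHardyLittlewood.Theorems.BeyondDiagonalBeatsQuarter.OffDiagPrincipalShortBound
import Summits.Parity.GeneralizedHardyLittlewood.Theorems.BeyondDiagonalBeatsQuarter.PeterssonSplit
import HarnessLib

/-!
# Route `PrimeLevelFamEdge`, crux K_B (stmt-Parity-20343), line `diagonal_kernel_split` rev 4, plan Ω,
# OMEGA-BLUEPRINT v4 §3c / TRANSITION-SIZING §4.2+§7 — **the a8P-SHORT bound, part 2: the two halves of the
# assembly skeleton `OffDiagPrincipalShortBound` in CLOSED FORM, and the mollifier weights in W4's currency**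

`OffDiagPrincipalShortBound` (p650569) bounds the principal block term summed against the mollifier by
`φ(n)⁻¹·|h₁|·Σ_{q unit} (Σ_{k≤K₀} U₄ q k + U₃ q)` for ANY per-sample bounds `U₄` (few turns, W4) and `U₃` (the
`k`-family, W3). This file supplies the two bounds in the shapes the tools actually deliver:

* §5 `mellinBump_xsq_e_complex` — W4 (`MellinBump.mellinBump_xsq_cos/_sin` via `mellinBump_xsq_e`) for a COMPLEX
  window `G` (`K`-Lipschitz in norm, support in `[a,b] ⊂ [a₀,∞)`, `‖G‖ ≤ B`) times the complex phase `e(Θ·m₁m₂/Y)`;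
  `mellinBump_bound_mono` (the C1 bound is monotone in the number of turns); **`sum_Icc_norm_mellinBump_le`** — the
  few-turns half in closed form: samples `k ≤ K₀` with `Θ_k = k·Θ₁` and windows `G_k` sharing `(K, B, [a,b])` give
  `Σ_{k≤K₀} ‖S k‖ ≤ K₀·D·((2B + (K + 2πK₀|Θ₁|B)(b−a))(1+|log b|) + 2(K + 2πK₀|Θ₁|B)√(bY)/Y)/(1 + log Y)^A`
  (the «`Θ₀`-polylog/(1+log Y)^A» term, `Θ₀ = K₀|Θ₁|`); `card_Ioc_filter_intCast_eq_le_nat` +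
  **`sum_Ioc_norm_productPhase_le`** — the `k`-family half in closed form on `(K₀, N]`:
  `Σ_{K₀<k≤N} ‖Σ_p c p·e(σν_p k/D)‖ ≤ √(N−K₀)·√(((N−K₀)/D + 1)·((Y+1+2D)·(d·Σ_p ‖c p‖²)))` (`σ = ±1`);
* §6 `mollifierCoeff_mul_eq_xsq_div_mul`, `sum_mollifierCoeff_mul_eq_sum_xsq`, `sqrt_mul_apply_eq_window` — the
  mollifier weights `c_l c_m = (x_l/l)(x_m/m)·√(lm)` (`PeterssonSplit.mollifierCoeff_X_sq`), so the sample sums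
  `Σ_{l,m} c_l c_m·F(lm)` ARE W4's `Σ (x_l/l)(x_m/m)·G(lm/Y)` with `G(y) = √(Yy)·F(Yy)`.

Still NOT here (the a8P owner's instantiation): the constants `(K, B, [a,b])` of `y ↦ √(Yy)·𝓕₁boxWeight(…; Yy-dependent)`
and the finite-rank separation of the `k`-dependence of the box transform for the `k`-family half; the fibre count `d`
(prover-4 `OffDiagFlatnessCount`). Theorems only; standard axioms. Helper toward `stub_offDiagBelowSlack_io`; closes nothing.
«The programme SEARCHES and TYPES; no claim about Landau–Siegel zeros, Theorems 1–2 of arXiv:2211.02515 or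
a repaired Margin232 until a kernel theorem says so.»
-/

noncomputable section

open Real MeasureTheory Filter Complex Finset
open scoped FourierTransform Topology ContDiff ComplexConjugate

namespace Summit.Parity.GeneralizedHardyLittlewood.Theorems.BeyondDiagonalBeatsQuarter.OffDiag

open Literature.NumberTheory.Sieve.FriedlanderIwaniecPrimes (fourier2)
open Literature.NumberTheory.Sieve.LargeSieve (e e_eq_exp e_add conj_e norm_e)
open Literature.NumberTheory.LFunctions.KMV2000 (mollifierCoeff)
open KernelFormXSq (xsq)
open Polynomial (X)

/-! ### §5. W4 for COMPLEX sample weights, and the few-turns half in closed form -/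

/-- **C1 with a complex phase AND a complex window.** For `G : ℝ → ℂ` with `‖G x − G y‖ ≤ K|x − y|`, supported in
`[a,b] ⊂ [a₀,∞)`, `‖G‖ ≤ B`, every real `Θ`, `M > 1`, `Y ≥ 1`:
`‖Σ_{m₁,m₂ ≤ M} (x_{m₁}/m₁)(x_{m₂}/m₂)·G(m₁m₂/Y)·e(Θ·m₁m₂/Y)‖
   ≤ D·((2B + (K + 2π|Θ|B)(b − a))(1 + |log b|) + 2(K + 2π|Θ|B)·√(bY)/Y)/(1 + log Y)^k`
(real and imaginary parts of `G` by `mellinBump_xsq_e`; `D = 2·D_e`). This is the shape of the sample sums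
`S(q,k)` of `OffDiagPrincipalShortBound` §1 once the box transform is read as a function of `lm/Y` (`mollifierCoeff_mul_eq_xsq_div_mul`).
[cite: KowalskiMichelVanderKam2000, Prop. 5.1 p. 18 — derivation; MontgomeryVaughan2007, §8.1 (8.6)] -/
theorem mellinBump_xsq_e_complex (k : ℕ) {a₀ : ℝ} (ha₀ : 0 < a₀) :
    ∃ D : ℝ, 0 < D ∧ ∀ a b K B Θ : ℝ, a₀ ≤ a → a ≤ b → 0 ≤ K →
      ∀ G : ℝ → ℂ, (∀ x y, ‖G x - G y‖ ≤ K * |x - y|) →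
      (∀ y, G y ≠ 0 → a ≤ y ∧ y ≤ b) → (∀ y, ‖G y‖ ≤ B) → ∀ M : ℝ, 1 < M → ∀ Y : ℝ, 1 ≤ Y →
        ‖∑ m₁ ∈ Icc 1 ⌊M⌋₊, ∑ m₂ ∈ Icc 1 ⌊M⌋₊,
            ((xsq M m₁ / m₁ * (xsq M m₂ / m₂) : ℝ) : ℂ) * G ((m₁ : ℝ) * m₂ / Y) *
              (𝐞 (Θ * ((m₁ : ℝ) * m₂ / Y)) : ℂ)‖ ≤
          D * ((2 * B + (K + 2 * π * |Θ| * B) * (b - a)) * (1 + |Real.log b|) +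
            2 * (K + 2 * π * |Θ| * B) * (Real.sqrt (b * Y) / Y)) / (1 + Real.log Y) ^ k := by
  obtain ⟨D, hD, hmain⟩ := mellinBump_xsq_e k ha₀
  refine ⟨2 * D, by positivity, fun a b K B Θ ha hab hK G hLip hsupp hB M hM Y hY ↦ ?_⟩
  -- real and imaginary parts of `G` are admissible real windows
  have hre := hmain a b K B Θ ha hab hK (fun y ↦ (G y).re)
    (fun x y ↦ by
      rw [← Complex.sub_re]
      exact (Complex.abs_re_le_norm _).trans (hLip x y))
    (fun y hy ↦ hsupp y fun h0 ↦ hy (by rw [h0, Complex.zero_re]))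
    (fun y ↦ (Complex.abs_re_le_norm _).trans (hB y)) M hM Y hY
  have him := hmain a b K B Θ ha hab hK (fun y ↦ (G y).im)
    (fun x y ↦ by
      rw [← Complex.sub_im]
      exact (Complex.abs_im_le_norm _).trans (hLip x y))
    (fun y hy ↦ hsupp y fun h0 ↦ hy (by rw [h0, Complex.zero_im]))
    (fun y ↦ (Complex.abs_im_le_norm _).trans (hB y)) M hM Y hY
  set X : ℝ := ((2 * B + (K + 2 * π * |Θ| * B) * (b - a)) * (1 + |Real.log b|) +
    2 * (K + 2 * π * |Θ| * B) * (Real.sqrt (b * Y) / Y)) / (1 + Real.log Y) ^ k with hX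
  set Sre : ℂ := ∑ m₁ ∈ Icc 1 ⌊M⌋₊, ∑ m₂ ∈ Icc 1 ⌊M⌋₊,
    ((xsq M m₁ / m₁ * (xsq M m₂ / m₂) * (G ((m₁ : ℝ) * m₂ / Y)).re : ℝ) : ℂ) *
      (𝐞 (Θ * ((m₁ : ℝ) * m₂ / Y)) : ℂ) with hSre
  set Sim : ℂ := ∑ m₁ ∈ Icc 1 ⌊M⌋₊, ∑ m₂ ∈ Icc 1 ⌊M⌋₊,
    ((xsq M m₁ / m₁ * (xsq M m₂ / m₂) * (G ((m₁ : ℝ) * m₂ / Y)).im : ℝ) : ℂ) *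
      (𝐞 (Θ * ((m₁ : ℝ) * m₂ / Y)) : ℂ) with hSim
  have hsplit : ∑ m₁ ∈ Icc 1 ⌊M⌋₊, ∑ m₂ ∈ Icc 1 ⌊M⌋₊,
      ((xsq M m₁ / m₁ * (xsq M m₂ / m₂) : ℝ) : ℂ) * G ((m₁ : ℝ) * m₂ / Y) * (𝐞 (Θ * ((m₁ : ℝ) * m₂ / Y)) : ℂ) =
      Sre + Sim * I := by
    rw [hSre, hSim, Finset.sum_mul, ← Finset.sum_add_distrib]
    refine Finset.sum_congr rfl fun m₁ _ ↦ ?_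
    rw [Finset.sum_mul, ← Finset.sum_add_distrib]
    refine Finset.sum_congr rfl fun m₂ _ ↦ ?_
    set g : ℂ := G ((m₁ : ℝ) * m₂ / Y) with hg
    calc (((xsq M m₁ / m₁ * (xsq M m₂ / m₂) : ℝ) : ℂ)) * g * (𝐞 (Θ * ((m₁ : ℝ) * m₂ / Y)) : ℂ)
        = (((xsq M m₁ / m₁ * (xsq M m₂ / m₂) : ℝ) : ℂ)) * ((g.re : ℂ) + (g.im : ℂ) * I) *
            (𝐞 (Θ * ((m₁ : ℝ) * m₂ / Y)) : ℂ) := by rw [Complex.re_add_im]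
      _ = _ := by push_cast; ring
  calc ‖∑ m₁ ∈ Icc 1 ⌊M⌋₊, ∑ m₂ ∈ Icc 1 ⌊M⌋₊,
        ((xsq M m₁ / m₁ * (xsq M m₂ / m₂) : ℝ) : ℂ) * G ((m₁ : ℝ) * m₂ / Y) * (𝐞 (Θ * ((m₁ : ℝ) * m₂ / Y)) : ℂ)‖
      = ‖Sre + Sim * I‖ := by rw [hsplit]
    _ ≤ ‖Sre‖ + ‖Sim * I‖ := norm_add_le _ _
    _ = ‖Sre‖ + ‖Sim‖ := by rw [norm_mul, Complex.norm_I, mul_one]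
    _ ≤ D * X + D * X := by
        have h1 : ‖Sre‖ ≤ D * X := by rw [hX, ← mul_div_assoc]; exact hre
        have h2 : ‖Sim‖ ≤ D * X := by rw [hX, ← mul_div_assoc]; exact him
        exact add_le_add h1 h2
    _ = 2 * D * X := by ring
    _ = _ := by rw [hX, ← mul_div_assoc]

/-- The C1-with-phase bound is monotone in the number of turns `|Θ|` (for `B ≥ 0`, `a ≤ b`, `Y ≥ 0`).
[folklore] -/
theorem mellinBump_bound_mono {a b K B T T' Y L : ℝ} (hB : 0 ≤ B) (hab : a ≤ b) (hY : 0 ≤ Y) (hL : 0 < L)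
    (hT : T ≤ T') :
    ((2 * B + (K + 2 * π * T * B) * (b - a)) * (1 + |Real.log b|) +
        2 * (K + 2 * π * T * B) * (Real.sqrt (b * Y) / Y)) / L ≤
      ((2 * B + (K + 2 * π * T' * B) * (b - a)) * (1 + |Real.log b|) +
        2 * (K + 2 * π * T' * B) * (Real.sqrt (b * Y) / Y)) / L := by
  have hba : 0 ≤ b - a := sub_nonneg.2 hab
  have hlog : 0 ≤ 1 + |Real.log b| := by positivity
  have hsq : 0 ≤ Real.sqrt (b * Y) / Y := div_nonneg (Real.sqrt_nonneg _) hY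
  have hKT : K + 2 * π * T * B ≤ K + 2 * π * T' * B := by
    have h2 : 0 ≤ 2 * π * B * (T' - T) := mul_nonneg (by positivity) (sub_nonneg.2 hT)
    nlinarith [h2]
  gcongr

/-- **The few-turns half in closed form.** For samples `k = 1,…,K₀` with `Θ_k = k·Θ₁` turns and complex windows
`G_k` sharing the data `(K, B, [a,b])` (`K`-Lipschitz, support in `[a,b] ⊂ [a₀,∞)`, `‖G_k‖ ≤ B`), `M > 1`, `Y ≥ 1`:
`Σ_{k∈[1,K₀]} ‖Σ_{m₁,m₂≤M} (x_{m₁}/m₁)(x_{m₂}/m₂)·G_k(m₁m₂/Y)·e(kΘ₁·m₁m₂/Y)‖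
   ≤ K₀·D·((2B + (K + 2π·K₀|Θ₁|·B)(b − a))(1 + |log b|) + 2(K + 2π·K₀|Θ₁|·B)·√(bY)/Y)/(1 + log Y)^A`
— the «`Θ₀`-polylog/(1 + log Y)^A» term of the a8P-short bound with `Θ₀ = K₀|Θ₁|` (the `U₄`-sum of
`norm_sum_mul_tsum_levelPrincipal_le_of_split`). [folklore] -/
theorem sum_Icc_norm_mellinBump_le (A : ℕ) {a₀ : ℝ} (ha₀ : 0 < a₀) :
    ∃ D : ℝ, 0 < D ∧ ∀ a b K B Θ₁ : ℝ, a₀ ≤ a → a ≤ b → 0 ≤ K →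
      ∀ M : ℝ, 1 < M → ∀ Y : ℝ, 1 ≤ Y → ∀ K₀ : ℕ, ∀ G : ℤ → ℝ → ℂ,
      (∀ k ∈ Finset.Icc (1 : ℤ) K₀, ∀ x y, ‖G k x - G k y‖ ≤ K * |x - y|) →
      (∀ k ∈ Finset.Icc (1 : ℤ) K₀, ∀ y, G k y ≠ 0 → a ≤ y ∧ y ≤ b) →
      (∀ k ∈ Finset.Icc (1 : ℤ) K₀, ∀ y, ‖G k y‖ ≤ B) →
        ∑ k ∈ Finset.Icc (1 : ℤ) K₀, ‖∑ m₁ ∈ Icc 1 ⌊M⌋₊, ∑ m₂ ∈ Icc 1 ⌊M⌋₊,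
            ((xsq M m₁ / m₁ * (xsq M m₂ / m₂) : ℝ) : ℂ) * G k ((m₁ : ℝ) * m₂ / Y) *
              (𝐞 (((k : ℝ) * Θ₁) * ((m₁ : ℝ) * m₂ / Y)) : ℂ)‖ ≤
          K₀ * (D * ((2 * B + (K + 2 * π * (K₀ * |Θ₁|) * B) * (b - a)) * (1 + |Real.log b|) +
            2 * (K + 2 * π * (K₀ * |Θ₁|) * B) * (Real.sqrt (b * Y) / Y)) / (1 + Real.log Y) ^ A) := by
  obtain ⟨D, hD, hmain⟩ := mellinBump_xsq_e_complex A ha₀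
  refine ⟨D, hD, fun a b K B Θ₁ ha hab hK M hM Y hY K₀ G hLip hsupp hB ↦ ?_⟩
  rcases Nat.eq_zero_or_pos K₀ with rfl | hK₀
  · simp
  have hB0 : 0 ≤ B := (norm_nonneg _).trans (hB 1 (by simp; omega) 0)
  have hY0 : 0 ≤ Y := by linarith
  have hL : 0 < (1 + Real.log Y) ^ A := pow_pos (by linarith [Real.log_nonneg hY]) A
  have hterm : ∀ k ∈ Finset.Icc (1 : ℤ) K₀, ‖∑ m₁ ∈ Icc 1 ⌊M⌋₊, ∑ m₂ ∈ Icc 1 ⌊M⌋₊,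
      ((xsq M m₁ / m₁ * (xsq M m₂ / m₂) : ℝ) : ℂ) * G k ((m₁ : ℝ) * m₂ / Y) *
        (𝐞 (((k : ℝ) * Θ₁) * ((m₁ : ℝ) * m₂ / Y)) : ℂ)‖ ≤
      D * ((2 * B + (K + 2 * π * (K₀ * |Θ₁|) * B) * (b - a)) * (1 + |Real.log b|) +
        2 * (K + 2 * π * (K₀ * |Θ₁|) * B) * (Real.sqrt (b * Y) / Y)) / (1 + Real.log Y) ^ A := by
    intro k hk
    have h := hmain a b K B ((k : ℝ) * Θ₁) ha hab hK (G k) (hLip k hk) (hsupp k hk) (hB k hk) M hM Y hY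
    refine h.trans ?_
    rw [mul_div_assoc, mul_div_assoc]
    refine mul_le_mul_of_nonneg_left (mellinBump_bound_mono hB0 hab hY0 hL ?_) hD.le
    rw [abs_mul]
    have hk1 : |(k : ℝ)| ≤ K₀ := by
      rw [Finset.mem_Icc] at hk
      rw [abs_of_pos (by exact_mod_cast hk.1)]
      exact_mod_cast hk.2
    exact mul_le_mul_of_nonneg_right hk1 (abs_nonneg _)
  calc ∑ k ∈ Finset.Icc (1 : ℤ) K₀, ‖∑ m₁ ∈ Icc 1 ⌊M⌋₊, ∑ m₂ ∈ Icc 1 ⌊M⌋₊,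
        ((xsq M m₁ / m₁ * (xsq M m₂ / m₂) : ℝ) : ℂ) * G k ((m₁ : ℝ) * m₂ / Y) *
          (𝐞 (((k : ℝ) * Θ₁) * ((m₁ : ℝ) * m₂ / Y)) : ℂ)‖
      ≤ ∑ k ∈ Finset.Icc (1 : ℤ) K₀, D * ((2 * B + (K + 2 * π * (K₀ * |Θ₁|) * B) * (b - a)) *
          (1 + |Real.log b|) + 2 * (K + 2 * π * (K₀ * |Θ₁|) * B) * (Real.sqrt (b * Y) / Y)) /
            (1 + Real.log Y) ^ A := Finset.sum_le_sum hterm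
    _ = _ := by rw [Finset.sum_const, nsmul_eq_mul, Int.card_Icc, add_sub_cancel_right, Int.toNat_natCast]

/-- **Multiplicity of the sample interval, natural-number form**: for `K₀ ≤ N`, `D ≥ 1` and any residue `r`,
`#{k ∈ (K₀, N] : k ≡ r (mod D)} ≤ (N − K₀)/D + 1` (floor division; from prover-9's real-valued
`card_Ioc_filter_intCast_eq_le`). [folklore] -/
theorem card_Ioc_filter_intCast_eq_le_nat {D : ℕ} (hD : 0 < D) {K₀ N : ℕ} (hK : K₀ ≤ N) (r : ZMod D) :
    ((Finset.Ioc (K₀ : ℤ) N).filter (fun k : ℤ ↦ (k : ZMod D) = r)).card ≤ (N - K₀) / D + 1 := by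
  have h := card_Ioc_filter_intCast_eq_le hD (by exact_mod_cast hK : (K₀ : ℤ) ≤ N) r
  have h' : ((((Finset.Ioc (K₀ : ℤ) N).filter (fun k : ℤ ↦ (k : ZMod D) = r)).card : ℕ) : ℝ) ≤
      ((N - K₀ : ℕ) : ℝ) / D + 1 := by
    rw [Nat.cast_sub hK]; push_cast at h ⊢; exact h
  have h2 := Nat.le_floor h'
  rwa [Nat.floor_add_one (by positivity), Nat.floor_div_eq_div] at h2

/-- **The `k`-family half in closed form** on the sample interval `(K₀, N]` (`K₀ ≤ N`, `σ = ±1`):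
`Σ_{K₀<k≤N} ‖Σ_p c p·e(σ·ν_p k/D)‖ ≤ √(N − K₀)·√(((N − K₀)/D + 1)·((Y + 1 + 2D)·(d·Σ_p ‖c p‖²)))`
— the `U₃` of `norm_sum_mul_tsum_levelPrincipal_le_of_split` for `k`-FREE pair coefficients (relative saving
`≍ ((1/D + 1/(N−K₀))·Y·d)^{1/2}` against the trivial `(N − K₀)·Σ|c|`). [folklore] -/
theorem sum_Ioc_norm_productPhase_le {ι : Type*} (P : Finset ι) (ν : ι → ℕ) {Y : ℕ}
    (hν : ∀ p ∈ P, ν p ∈ Icc 1 Y) {d : ℕ} (hd : ∀ p ∈ P, (P.filter (fun p' ↦ ν p' = ν p)).card ≤ d)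
    (c : ι → ℂ) {D : ℕ} (hD : 0 < D) {K₀ N : ℕ} (hK : K₀ ≤ N) {σ : ℝ} (hσ : σ = 1 ∨ σ = -1) :
    ∑ k ∈ Finset.Ioc (K₀ : ℤ) N, ‖∑ p ∈ P, c p * e (σ * ((ν p : ℝ) * k / D))‖ ≤
      Real.sqrt ((N - K₀ : ℕ) : ℝ) *
        Real.sqrt ((((N - K₀) / D + 1 : ℕ) : ℝ) * (((Y : ℝ) + 1 + 2 * D) * (d * ∑ p ∈ P, ‖c p‖ ^ 2))) := by
  have h := sum_norm_productPhase_le_sqrt P ν hν hd c (Finset.Ioc (K₀ : ℤ) N) hD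
    (card_Ioc_filter_intCast_eq_le_nat hD hK) hσ
  rwa [Int.card_Ioc, ← Nat.cast_sub hK, Int.toNat_natCast] at h

/-! ### §6. The mollifier weights in `xsq`-form (the currency of W4) -/

/-- **Mollifier weights as `xsq`-weights of the product.** For `l, m ≥ 1`:
`c_l·c_m = (x_l/l)(x_m/m)·√(l·m)` with `c = mollifierCoeff X² M`, `x = xsq M`
(`PeterssonSplit.mollifierCoeff_X_sq`: `c_m = x_m·m^{−1/2}`). [folklore] -/
theorem mollifierCoeff_mul_eq_xsq_div_mul (M : ℝ) {l m : ℕ} (hl : 1 ≤ l) (hm : 1 ≤ m) :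
    mollifierCoeff (X ^ 2) M l * mollifierCoeff (X ^ 2) M m =
      xsq M l / l * (xsq M m / m) * Real.sqrt ((l : ℝ) * m) := by
  have hl0 : (0 : ℝ) < l := by exact_mod_cast hl
  have hm0 : (0 : ℝ) < m := by exact_mod_cast hm
  rw [PeterssonSplit.mollifierCoeff_X_sq, PeterssonSplit.mollifierCoeff_X_sq,
    Real.sqrt_eq_rpow, Real.mul_rpow hl0.le hm0.le]
  have hl' : (l : ℝ) ^ (-(1 / 2 : ℝ)) = (l : ℝ) ^ (1 / 2 : ℝ) / l := by
    rw [eq_div_iff hl0.ne', ← Real.rpow_add_one hl0.ne']; norm_num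
  have hm' : (m : ℝ) ^ (-(1 / 2 : ℝ)) = (m : ℝ) ^ (1 / 2 : ℝ) / m := by
    rw [eq_div_iff hm0.ne', ← Real.rpow_add_one hm0.ne']; norm_num
  rw [hl', hm']
  ring

/-- **The `(l,m)`-sum against the mollifier in W4's currency.** For any weight `F` of the product `l·m`:
`Σ_{l,m∈[1,⌊M⌋]} c_l c_m·F(l·m) = Σ_{l,m} ((x_l/l)(x_m/m) : ℂ)·(√(lm)·F(lm))`, i.e. with `Y > 0` and
`G(y) := √(Y·y)·F(Y·y)` the sample sum is `Σ (x_l/l)(x_m/m)·G(lm/Y)` — the input shape of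
`mellinBump_xsq_e_complex`. [folklore] -/
theorem sum_mollifierCoeff_mul_eq_sum_xsq (M : ℝ) (F : ℝ → ℂ) :
    ∑ l ∈ Icc 1 ⌊M⌋₊, ∑ m ∈ Icc 1 ⌊M⌋₊,
        ((mollifierCoeff (X ^ 2) M l * mollifierCoeff (X ^ 2) M m : ℝ) : ℂ) * F ((l : ℝ) * m) =
      ∑ l ∈ Icc 1 ⌊M⌋₊, ∑ m ∈ Icc 1 ⌊M⌋₊,
        ((xsq M l / l * (xsq M m / m) : ℝ) : ℂ) * ((Real.sqrt ((l : ℝ) * m) : ℂ) * F ((l : ℝ) * m)) := by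
  refine Finset.sum_congr rfl fun l hl ↦ Finset.sum_congr rfl fun m hm ↦ ?_
  rw [mollifierCoeff_mul_eq_xsq_div_mul M (Finset.mem_Icc.1 hl).1 (Finset.mem_Icc.1 hm).1]
  push_cast
  ring

/-- The rescaled window: `√(l·m)·F(l·m) = G(lm/Y)` with `G(y) := √(Y·y)·F(Y·y)`, `Y > 0`. [folklore] -/
theorem sqrt_mul_apply_eq_window {Y : ℝ} (hY : 0 < Y) (F : ℝ → ℂ) (u : ℝ) :
    (Real.sqrt u : ℂ) * F u = (fun y : ℝ ↦ ((Real.sqrt (Y * y) : ℝ) : ℂ) * F (Y * y)) (u / Y) := by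
  simp only [mul_div_cancel₀ u hY.ne']

end Summit.Parity.GeneralizedHardyLittlewood.Theorems.BeyondDiagonalBeatsQuarter.OffDiag
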